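import Summits.BirchSwinnertonDyer.BirchSwinnertonDyer.Theorems.PrintX8SmallImageRiderRankZero
import Summits.BirchSwinnertonDyer.BirchSwinnertonDyer.Theorems.PrintX8SharpFlatMuDefect
import Summits.BirchSwinnertonDyer.Rank1Residual.PrintX8.CertificateClaim
import HarnessLib

/-!
# Route `PrintX8`, crux `MuBoundSmallImageX8` (stmt-BirchSwinnertonDyer-20622), ANALYTIC RANK `0`, part 4:
# ONE colour of unit content + `BSD(E,3)` ⟹ Sprung's Main Conjecture 7.21 for BOTH colours (and K1's
# predicate for both) on the small-image X8 pairs — the `μ`-BOUND (not `μ = 0`) already makes Kato's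
# rational divisibility integral (cell `bsd-print-x8`, D-0131 (2) print tier, seat p3 gen 2; `--supports`
# 20622; theorems only)

PARTITION (cell bsd-print-x8, leaf `ClassX8`; 217 census cells, 61 with image `N_ns⁺(3)`): per-pair and
class theorems CONDITIONAL on published named facts + the displayed ONE-colour analytic rider; closes
NONE as a class; 0 census cells move by class theorem; BSD is not proved by any of this.
beyond-print theorem: YES (as parts 1–3).

HONEST FRAMING. Part 2 (`PrintX8SmallImageRiderMainConjecture`, p550798) derived Main Conj. 7.21 at a
rank-`0` small-image X8 pair for the colour `•` CARRYING the rider (`μ(X^•) = 0` ⟹ `ξ^• ∣ L^•`). THIS file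
removes the restriction: the `μ`-BOUND `μ(X^•) ≤ μ(Λ/(L^•))` — item 20622's own inequality, which ONE
colour `•₀` of unit content delivers for EVERY colour `•` (p1 g2 `PrintX8SharpFlatMuDefect`,
`X8.sharpFlatMu_le_of_oneColour_hasUnitContent`: LEMMA B + `length_(3) X₀ = 0` through the core) —
ALREADY makes Sprung 2012 Thm. 7.16's rational clause integral: if `ξ ∣ 3ⁿ·L` and `μ(Λ/(ξ)) ≤ μ(Λ/(L))`
then `ξ ∣ L` (§8: content factorisations `ξ = 3^a ξ′`, `L = 3^m L′`, `a ≤ m`, Gauss on the `3`-free parts).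
So at rank `0`: ONE certified Mazur–Tate layer (either parity) + `BSD(E,3)` (from part 1 when
`3 ∤ #Ш_an`, from part 3 / b2b's descent when `#Ш_an = 9`) ⟹ `char X^• = (ϖ̃ L^•)` for `• = ♯` AND
`• = ♭` — the FULL statement of item 20402 at the pair, and K1's (19875) for both colours, K1-FREE.
Consequence for the census (54 + 5 rank-`0` small-image cells): per pair, ONE layer certificate suffices
for both colours (part 2 §4's `…_of_sharpFlatMuAn` needed the rider for each colour separately).
Also recorded (§8, image-free, rank-free): «Mu (20622's inequality at a pair and colour) ⟹ the INTEGRAL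
Kato divisibility `ξ^• ∣ L^•` there» — so 20622 is, modulo Sprung 2012 Thm. 7.16, exactly the
integrality of Kato's divisibility at image `N_ns⁺(3)` (p3 g1's reading `char X^• = (3^m L^•)` said the
same given K1; here WITHOUT K1).

## Contents
* §8 `dvd_of_dvd_pow_mul_of_muInvariant_quotient_le` (Λ-algebra) and
  `sharpFlatUpper_dvd_of_muInvariant_le` (Thm. 7.16 rational + `μ(X^•) ≤ μ(Λ/(L^•))` ⟹ `ξ ∣ L^•`).
* §9 PER PAIR: `X8.sprungSharpFlatMainConjecture_of_bsdp_of_oneColourRider_…` (BSD(E,3) + one-colour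
  rider ⟹ MC 7.21 for EVERY colour); `…_of_oneColourRider_of_shaAn_le_…`; `X8.sprungSharpFlatLowerDivisibility_…`.
* §10 CLASS FORM on X8 ∩ {¬surj(3)} ∩ {r_an = 0} ∩ {3 ∤ #Ш_an}: items 20402 ∧ 19875 there from the
  ONE-colour rider (sharpens part 2's `…_of_sharpFlatMuAn`).

What is NOT here: rank `1`; 288800cu1; any class-wide source of the rider; anything booked.
References: [Sprung2012] Thm. 7.14, Thm. 7.16 (p. 1504), Main Conj. 7.21 (p. 1505); [Sprung2024] §5.2;
[Washington1997] §7.1, §13.2; [GreenbergVatsal2000] p. 2 (1)–(2); [Miller2011LMS] Def. 1.1; tree: parts 1–3,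
p1 g2 `PrintX8SharpFlatMuDefect` (p546801), K3 `…SmallImageSignedMuOneSign` (content factorisation),
b2b `SharpFlatConverseReal`.
-/

set_option autoImplicit false
-- justification: the mandated namespace `Summit.BirchSwinnertonDyer.BirchSwinnertonDyer.Theorems`
-- (single-conjunct summit, Sub = Summit) repeats a segment by design (D-0017).
set_option linter.dupNamespace false

noncomputable section

open scoped Classical NumberField MatrixGroups ModularForm

open NumberField IsDedekindDomain WeierstrassCurve CongruenceSubgroup Field
  Literature.NumberTheory.EllipticCurves Literature.NumberTheory.EllipticCurves.ModularForms
  Literature.NumberTheory.EllipticCurves.Rank1Residual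
  Literature.NumberTheory.EllipticCurves.Rank1Residual.Typed
  Literature.NumberTheory.EllipticCurves.Sprung2017 Literature.NumberTheory.EllipticCurves.Sprung2012
  Literature.NumberTheory.EllipticCurves.Sprung2024
  Literature.NumberTheory.EllipticCurves.GreenbergVatsal2000
  Literature.NumberTheory.EllipticCurves.ZpExtension Literature.NumberTheory.EllipticCurves.IwasawaAlgebra
  Literature.NumberTheory.EllipticCurves.BurungaleTian2026
  Summit.BirchSwinnertonDyer.BirchSwinnertonDyer.Theorems
  Summit.BirchSwinnertonDyer.BirchSwinnertonDyer.Theorems.PrintX8SmallImageRiderRankZero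
  Summit.BirchSwinnertonDyer.BirchSwinnertonDyer.Theorems.SmallImageSignedMuTransfer
  Summit.BirchSwinnertonDyer.Rank1Residual.Supersingular

namespace Summit.BirchSwinnertonDyer.BirchSwinnertonDyer.Theorems.PrintX8SmallImageRiderBothColours

/-! ### §8 Λ-algebra: a divisor of `pⁿ·L` whose `μ` does not exceed `μ(L)` divides `L` -/

section Algebra

variable {p : ℕ} [Fact p.Prime]

/-- **In `Λ = ℤ_p⟦T⟧`: if `ξ ∣ pⁿ · L` (`L ≠ 0`) and `μ(Λ/(ξ)) ≤ μ(Λ/(L))`, then `ξ ∣ L`.** Content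
factorisations `ξ = p^a ξ′`, `L = p^m L′` with `p ∤ ξ′, L′` (`Λ` Noetherian; `μ(Λ/(p^k g′)) = k` for
`p ∤ g′`, Washington §13.2), so `a ≤ m`; `ξ′ ∣ p^{n+m} L′` gives `ξ′ ∣ L′` by Gauss' lemma for the prime
`p ∈ Λ` (`Additive.dvd_of_dvd_C_pow_mul_of_hasUnitContent`); hence `ξ = p^a ξ′ ∣ p^m L′ = L`.
[cite: Washington1997, §7.1 and §13.2] -/
theorem dvd_of_dvd_pow_mul_of_muInvariant_quotient_le {ξ L : IwasawaAlgebra p} (hL : L ≠ 0) {n : ℕ}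
    (hdvd : ξ ∣ (p : IwasawaAlgebra p) ^ n * L)
    (hμ : muInvariant p (IwasawaAlgebra p ⧸ Ideal.span {ξ}) ≤
      muInvariant p (IwasawaAlgebra p ⧸ Ideal.span {L})) : ξ ∣ L := by
  have hpC : ((p : IwasawaAlgebra p) ^ n : IwasawaAlgebra p) = PowerSeries.C (p : ℤ_[p]) ^ n := by
    rw [map_natCast]
  have hpn0 : (PowerSeries.C (p : ℤ_[p]) ^ n : IwasawaAlgebra p) ≠ 0 := pow_ne_zero _ (prime_C p).ne_zero
  have hξ : ξ ≠ 0 := by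
    rintro rfl
    rw [hpC] at hdvd
    exact (mul_ne_zero hpn0 hL) (zero_dvd_iff.mp hdvd)
  -- content factorisations
  obtain ⟨a, ξ', hξ', hξa⟩ := exists_eq_C_pow_mul_not_dvd hξ
  obtain ⟨m, L', hL', hLm⟩ := exists_eq_C_pow_mul_not_dvd hL
  let 𝔭 : PrimeSpectrum (IwasawaAlgebra p) := ⟨augIdealP p, isPrime_augIdealP_holds p⟩
  have hμξ : muInvariant p (IwasawaAlgebra p ⧸ Ideal.span {ξ}) = a := by
    rw [muInvariant_eq_toNat_lengthAt p _ 𝔭 rfl, lengthAt_quotient_span_eq_of_eq_C_pow_mul hξ' hξa 𝔭 rfl,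
      ENat.toNat_coe]
  have hμL : muInvariant p (IwasawaAlgebra p ⧸ Ideal.span {L}) = m := by
    rw [muInvariant_eq_toNat_lengthAt p _ 𝔭 rfl, lengthAt_quotient_span_eq_of_eq_C_pow_mul hL' hLm 𝔭 rfl,
      ENat.toNat_coe]
  rw [hμξ, hμL] at hμ
  -- `ξ′ ∣ p^{n+m} · L′`, hence `ξ′ ∣ L′` (Gauss)
  have h1 : ξ' ∣ PowerSeries.C ((p : ℤ_[p]) ^ (n + m)) * L' := by
    have hξ'ξ : ξ' ∣ ξ := ⟨PowerSeries.C (p : ℤ_[p]) ^ a, by rw [hξa, mul_comm]⟩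
    refine hξ'ξ.trans (hdvd.trans (dvd_of_eq ?_))
    rw [hpC, hLm, map_pow, pow_add, mul_assoc]
  have hu' : HasUnitContent ξ' := (hasUnitContent_iff_not_C_dvd ξ').mpr hξ'
  have h2 : ξ' ∣ L' :=
    Summit.BirchSwinnertonDyer.Rank1Residual.Additive.dvd_of_dvd_C_pow_mul_of_hasUnitContent hu' (n + m) h1
  -- `ξ = p^a ξ′ ∣ p^m L′ = L`
  rw [hξa, hLm]
  exact mul_dvd_mul (pow_dvd_pow _ hμ) h2

end Algebra

/-! ### §8b The ♯/♭ reading: the `μ`-BOUND makes Sprung 2012 Thm. 7.16 integral (image-free, rank-free) -/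

section Upper

variable {W : WeierstrassCurve ℚ} [W.IsElliptic] [W.IsGloballyMinimal] {p : ℕ} [Fact p.Prime]
  {N : ℕ} [NeZero N] {f : CuspForm (Gamma0 N) 2}
  {κ : ZpExtension ℚ p} {γ : absoluteGaloisGroup ℚ} {v : HeightOneSpectrum (𝓞 ℚ)}
  {g : absoluteGaloisGroup (v.adicCompletion ℚ)}
  {cneg : localPoints W (v.adicCompletion ℚ)} {c : ℕ → localPoints W (v.adicCompletion ℚ)}
  {col : Chroma} {Lsharp Lflat : IwasawaAlgebra p}

/-- **Mu ⟹ integral Kato, with NO hypothesis on the Galois image.** In the cyclotomic / Honda setting of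
Sprung 2012 Thm. 7.16, for a colour `•` with `L^• ≠ 0`, a dual datum `D` of `Sel^•(E/ℚ_∞)` (f.g. torsion)
with characteristic power series `ξ` and the `μ`-BOUND `μ(D.X) ≤ μ(Λ/(L^•))` (item 20622's inequality at
this pair and colour): **`ξ ∣ L^•_p(E)` in `Λ`** (§8 ∘ Thm. 7.16's rational clause ∘
`μ(D.X) = μ(Λ/(ξ))`, Washington §13.2). So modulo Thm. 7.16 the crux `MuBoundSmallImageX8` IS the
integrality of Kato's divisibility on the small-image pairs — K1-free (p3 g1's `PrintX8SmallImageMuReading`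
read it the same way GIVEN K1). [cite: Sprung2012, Thm. 7.16 (p. 1504)] [cite: Washington1997, §13.2] -/
theorem sharpFlatUpper_dvd_of_muInvariant_le (h716 : thm716_sharpFlatCharIdeal_divisibility)
    (hp : p ≠ 2) (hgood : W.HasGoodReductionAtPrime p) (hap : (p : ℤ) ∣ W.frobeniusTrace p)
    (hf : IsNewformOf W f) (hκ : κ.IsCyclotomic) (hγ : κ.IsTopGenerator γ)
    (hγ' : IsCyclotomicVariable p γ) (hv : (p : 𝓞 ℚ) ∈ v.asIdeal)
    (hg : κ.IsTopGenerator (resGalOfEmb (closureEmb (K := ℚ) (v.adicCompletion ℚ)) g))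
    (hH : IsHondaSystem κ (closureEmb (K := ℚ) (v.adicCompletion ℚ)) W (W.frobeniusTrace p) g cneg c)
    (hSP : IsSprungPair f p (W.frobeniusTrace p) Lsharp Lflat) (hL0 : chromaticL col Lsharp Lflat ≠ 0)
    (D : SharpFlatSelmerDualData W κ γ (closureEmb (K := ℚ) (v.adicCompletion ℚ))
      (W.frobeniusTrace p) g c col) [Module.Finite (IwasawaAlgebra p) D.X]
    (hX : Module.IsTorsion (IwasawaAlgebra p) D.X)
    {ξ : IwasawaAlgebra p} (hξ : D.charIdeal = Ideal.span {ξ})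
    (hμ : muInvariant p D.X ≤ muInvariant p (IwasawaAlgebra p ⧸ Ideal.span {chromaticL col Lsharp Lflat})) :
    ξ ∣ chromaticL col Lsharp Lflat := by
  obtain ⟨n, hn⟩ := h716.exists_dvd_pow_mul hp hgood hap hf hκ hγ hγ' hv hg hH hSP hL0 D hX hξ
  refine dvd_of_dvd_pow_mul_of_muInvariant_quotient_le hL0 hn ?_
  rwa [← muInvariant_eq_muInvariant_quotient_of_charIdeal_eq_span D.X hX hξ]

end Upper

/-! ### §9 PER PAIR: `BSD(E,3)` + ONE colour of unit content ⟹ Main Conj. 7.21 for EVERY colour -/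

section PerPair

variable (W : WeierstrassCurve ℚ) [W.IsElliptic] [W.IsGloballyMinimal] (p : ℕ) [Fact p.Prime]

/-- **X8 ∧ `¬ surj(3)` ∧ `r_an = 0`: a SETTLED `BSD(E,3)` + the ONE-colour rider ⟹ Sprung's Main
Conjecture 7.21 for `(E, 3, •)` for EVERY colour `•`** (the colour `•₀` of unit content may differ from `•`
and may depend on the newform / pair at hand). Chain inside the conjecture's binders: p1 g2's one-colour
`μ`-bound `μ(X^•) ≤ μ(Λ/(L^•))` (`X8.sharpFlatMu_le_of_oneColour_hasUnitContent`: core + LEMMA B); §8b ⟹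
`ξ ∣ L^•` integrally; the rank-`0` exact form `BSD(E,3) ⟺ (ξ) = (L^•)` (b2b, (K•) by Sprung 2024 §5.2,
`3 ∤ c_•`); the Néron generator `ϖ̃ L^•`. Named inputs: `hCK`, `h714`, `h716` (rational clause), `h59`,
`h3`, GZK, `hmod`. NO K1, image only «not onto». PER PAIR; conditional; closes nothing.
[cite: Sprung2012, Thm. 7.14, Thm. 7.16 (p. 1504) and Main Conj. 7.21 (p. 1505)]
[cite: Sprung2024, §5.2 Lemmas 5.5–5.9 (pp. 40–41)] [cite: Washington1997, §13.2] [cite: Miller2011LMS, Def. 1.1] -/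
theorem X8.sprungSharpFlatMainConjecture_of_bsdp_of_oneColourRider_of_not_surj_of_analyticRank_eq_zero
    (hCK : thm714seq_sharpFlatColemanKato_zeta) (h714 : thm714_sharpFlatSelmerDual_finite_torsion)
    (h716 : thm716_sharpFlatCharIdeal_divisibility) (h59 : lem59AllN_sharpFlatCharValue_rankZero)
    (h3 : realPeriodRat_eq_unit_mul_plusPeriod_three)
    (hGZK : rank_eq_analyticRank_of_analyticRank_le_one) (hmod : hasEntireLFunction_rat)
    (hX : ClassX8 W p) (hns : ¬ Surj W p) (h0 : W.analyticRank = 0) (hB : BSDp W p)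
    (hrider : ∀ (N : ℕ) (_ : NeZero N) (f : CuspForm (Gamma0 N) 2) (Lsharp Lflat : IwasawaAlgebra p),
      IsNewformOf W f → IsSprungPair f p (W.frobeniusTrace p) Lsharp Lflat →
      ∃ col₀ : Chroma, HasUnitContent (chromaticL col₀ Lsharp Lflat))
    (col : Chroma) : SprungSharpFlatMainConjecture W p col := by
  intro κ γ hκ hγ hγ' v hv g hg cneg c hc N hN f ϖ Lsharp Lflat hf hϖ hSP hcol D
  haveI := hN
  have hp3 : p = 3 := hX.1
  subst hp3
  have hp2 : (3 : ℕ) ≠ 2 := by decide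
  have hgood : W.HasGoodReductionAtPrime 3 := hX.2.1.1
  have hdvd : ((3 : ℕ) : ℤ) ∣ W.frobeniusTrace 3 := hX.2.1.2
  have hirr : W.HasIrreducibleModPGaloisRep 3 := ClassX8.irr W 3 hX
  have hL : W.entireLFunction 1 ≠ 0 := (W.analyticRank_eq_zero_iff_holds (hmod W)).1 h0
  obtain ⟨col₀, hu₀⟩ := hrider N hN f Lsharp Lflat hf hSP
  -- `X^•` finitely generated torsion (Thm. 7.14), a generator of `char X^•`, (K•)
  obtain ⟨hfinD, htorD⟩ :=
    h714 W 3 hp2 hgood hdvd f hf κ γ hκ hγ hγ' v hv g hg cneg c hc col Lsharp Lflat hSP hcol D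
  haveI := hfinD
  obtain ⟨gen, hgen⟩ := (charIdeal_isPrincipal_holds 3 D.X).principal
  have hchar : D.charIdeal = Ideal.span {gen} := hgen
  have hK : (⟨gen, 0, 0⟩ : SignedDatum W 3).EulerCharacteristic := fun hfin =>
    h59 W 3 hp2 hgood hdvd hL κ γ hκ hγ hγ' v hv g hg cneg c hc col D htorD gen hchar hfin
  -- the `μ`-bound for `•` from the `•₀`-rider (p1 g2), then §8b: integral Kato
  have hμle : muInvariant 3 D.X ≤
      muInvariant 3 (IwasawaAlgebra 3 ⧸ Ideal.span {chromaticL col Lsharp Lflat}) :=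
    PrintX8SharpFlatMuTransfer.X8.sharpFlatMu_le_of_oneColour_hasUnitContent W 3 hCK h3 hX hns f hf ϖ hϖ κ
      γ hκ hγ hγ' v hv g hg cneg c hc hSP col₀ hu₀ col hcol D
  have hKato : gen ∣ chromaticL col Lsharp Lflat :=
    sharpFlatUpper_dvd_of_muInvariant_le h716 hp2 hgood hdvd hf hκ hγ hγ' hv hg hc hSP hcol D htorD hchar hμle
  -- rank `0`: `BSD(E,3) ⟺ (gen) = (L^•)`
  have hspan : Ideal.span ({gen} : Set (IwasawaAlgebra 3)) =
      Ideal.span {chromaticL col Lsharp Lflat} :=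
    (bsdp_iff_span_eq_span_chromaticL_of_analyticRank_eq_zero W 3 hGZK hp2 hgood hirr hL hf
      (h3 W hgood hirr f hf) hSP col (ClassX8.not_dvd_chromaticConst' W 3 hX col) gen hK hKato).mp hB
  -- the Néron-normalised generator `ϖ̃ · L^•`
  have hϖ1 : ‖(ϖ : ℚ_[3])‖ = 1 := X8_norm_periodRatio_eq_one h3 W 3 hX hf hϖ
  obtain ⟨hspan', hι'⟩ := span_C_units_mul_eq (PadicInt.mkUnits hϖ1) (chromaticL col Lsharp Lflat)
  refine ⟨htorD, PowerSeries.C ((PadicInt.mkUnits hϖ1 : ℤ_[3]ˣ) : ℤ_[3]) *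
    chromaticL col Lsharp Lflat, ?_, ?_⟩
  · rw [hchar, hspan, hspan']
  · rw [hι', PadicInt.mkUnits_eq]

/-- **X8 ∧ `¬ surj(3)` ∧ `r_an = 0` ∧ `ord₃ #Ш_an ≤ 0`: the ONE-colour rider ALONE ⟹ Sprung's Main
Conjecture 7.21 for EVERY colour** (`BSD(E,3)` from part 1, then the previous theorem). On the census: the
54 rank-`0` small-image cells with `3 ∤ #Ш_an`, ONE Mazur–Tate layer certificate each (either parity).
Named inputs: `h22`, `hCK`, `h714`, `h716`, `h59`, `h3`, GZK, `hmod`. PER PAIR; conditional.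
[cite: Sprung2012, Main Conj. 7.21 (p. 1505)] [cite: Sprung2024, §5.2 Lemmas 5.5–5.9] [cite: Miller2011LMS, §1 and Def. 1.1] -/
theorem X8.sprungSharpFlatMainConjecture_of_oneColourRider_of_shaAn_le_of_not_surj_of_analyticRank_eq_zero
    (h22 : thm22_exists_isHondaSystem) (hCK : thm714seq_sharpFlatColemanKato_zeta)
    (h714 : thm714_sharpFlatSelmerDual_finite_torsion) (h716 : thm716_sharpFlatCharIdeal_divisibility)
    (h59 : lem59AllN_sharpFlatCharValue_rankZero) (h3 : realPeriodRat_eq_unit_mul_plusPeriod_three)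
    (hGZK : rank_eq_analyticRank_of_analyticRank_le_one) (hmod : hasEntireLFunction_rat)
    (hX : ClassX8 W p) (hns : ¬ Surj W p) (h0 : W.analyticRank = 0)
    (hrider : ∀ (N : ℕ) (_ : NeZero N) (f : CuspForm (Gamma0 N) 2) (Lsharp Lflat : IwasawaAlgebra p),
      IsNewformOf W f → IsSprungPair f p (W.frobeniusTrace p) Lsharp Lflat →
      ∃ col₀ : Chroma, HasUnitContent (chromaticL col₀ Lsharp Lflat))
    (hsha : ∃ q : ℚ, shaAn W = (q : ℂ) ∧ padicValRat p q ≤ 0) (col : Chroma) :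
    SprungSharpFlatMainConjecture W p col := by
  intro κ γ hκ hγ hγ' v hv g hg cneg c hc N hN f ϖ Lsharp Lflat hf hϖ hSP hcol D
  haveI := hN
  obtain ⟨col₀, hu₀⟩ := hrider N hN f Lsharp Lflat hf hSP
  have hB : BSDp W p :=
    X8.bsdp_of_hasUnitContent_of_shaAn_le_of_not_surj_of_analyticRank_eq_zero W p h22 h714 h716 hCK h59
      h3 hGZK hmod hX hns h0 hf hSP col₀ hu₀ hsha
  exact X8.sprungSharpFlatMainConjecture_of_bsdp_of_oneColourRider_of_not_surj_of_analyticRank_eq_zero W p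
    hCK h714 h716 h59 h3 hGZK hmod hX hns h0 hB hrider col κ γ hκ hγ hγ' v hv g hg cneg c hc N hN f ϖ
    Lsharp Lflat hf hϖ hSP hcol D

/-- **… and K1's predicate for EVERY colour** (edge «main conjecture ⇒ Eisenstein half»). PER PAIR.
[cite: Sprung2012, Main Conj. 1.3 (p. 1486) and Main Conj. 7.21 (p. 1505)] -/
theorem X8.sprungSharpFlatLowerDivisibility_of_oneColourRider_of_shaAn_le_of_not_surj_of_analyticRank_eq_zero
    (h22 : thm22_exists_isHondaSystem) (hCK : thm714seq_sharpFlatColemanKato_zeta)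
    (h714 : thm714_sharpFlatSelmerDual_finite_torsion) (h716 : thm716_sharpFlatCharIdeal_divisibility)
    (h59 : lem59AllN_sharpFlatCharValue_rankZero) (h3 : realPeriodRat_eq_unit_mul_plusPeriod_three)
    (hGZK : rank_eq_analyticRank_of_analyticRank_le_one) (hmod : hasEntireLFunction_rat)
    (hX : ClassX8 W p) (hns : ¬ Surj W p) (h0 : W.analyticRank = 0)
    (hrider : ∀ (N : ℕ) (_ : NeZero N) (f : CuspForm (Gamma0 N) 2) (Lsharp Lflat : IwasawaAlgebra p),
      IsNewformOf W f → IsSprungPair f p (W.frobeniusTrace p) Lsharp Lflat →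
      ∃ col₀ : Chroma, HasUnitContent (chromaticL col₀ Lsharp Lflat))
    (hsha : ∃ q : ℚ, shaAn W = (q : ℂ) ∧ padicValRat p q ≤ 0) (col : Chroma) :
    SprungSharpFlatLowerDivisibility W p col :=
  sprungSharpFlatLowerDivisibility_of_mainConjecture
    (X8.sprungSharpFlatMainConjecture_of_oneColourRider_of_shaAn_le_of_not_surj_of_analyticRank_eq_zero W p
      h22 hCK h714 h716 h59 h3 hGZK hmod hX hns h0 hrider hsha col)

end PerPair

/-! ### §10 CLASS FORM: items 20402 ∧ 19875 on X8 ∩ {¬surj(3)} ∩ {r_an = 0} ∩ {3 ∤ #Ш_an} from the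
ONE-colour rider (54 of the 61 small-image cells) -/

section ClassForms

/-- **CLASS FORM.** Granted the published named facts and the construction fact `hCK` BY NAME, the
ONE-colour analytic rider on X8 ∩ {ρ̄_{E,3} not onto} ∩ {r_an = 0} (per pair decidable by ONE Mazur–Tate
layer; class-wide ⟸ Perrin-Riou 2003 Conj. 7.1) implies, on the sub-population with `ord₃ #Ш_an ≤ 0`,
Sprung's Main Conjecture 7.21 AND its Eisenstein half for EVERY colour — the statements of items 20402
(`SharpFlatMainConjectureSmallImageX8`) and 19875 (K1) restricted there. K1-FREE, partner-free. Sharpens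
part 2's `sharpFlatMainConjecture_smallImage_rankZero_shaUnit_of_sharpFlatMuAn` (which needed the rider
per colour). Conditional; closes nothing. [cite: Sprung2012, Main Conj. 7.21 (p. 1505)]
[cite: PerrinRiou2003, Conj. 7.1 (p. 170)] [cite: Sprung2024, §5.2 Lemmas 5.5–5.9] [cite: Miller2011LMS, Def. 1.1] -/
theorem sharpFlatMainConjecture_smallImage_rankZero_shaUnit_of_oneColourRider
    (h22 : thm22_exists_isHondaSystem) (hCK : thm714seq_sharpFlatColemanKato_zeta)
    (h714 : thm714_sharpFlatSelmerDual_finite_torsion) (h716 : thm716_sharpFlatCharIdeal_divisibility)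
    (h59 : lem59AllN_sharpFlatCharValue_rankZero) (h3 : realPeriodRat_eq_unit_mul_plusPeriod_three)
    (hGZK : rank_eq_analyticRank_of_analyticRank_le_one) (hmod : hasEntireLFunction_rat)
    (hrider : ∀ (W : WeierstrassCurve ℚ) [W.IsElliptic] [W.IsGloballyMinimal] (p : ℕ) [Fact p.Prime],
        ClassX8 W p → ¬ Surj W p → W.analyticRank = 0 →
        ∀ (N : ℕ) (_ : NeZero N) (f : CuspForm (Gamma0 N) 2) (Lsharp Lflat : IwasawaAlgebra p),
        IsNewformOf W f → IsSprungPair f p (W.frobeniusTrace p) Lsharp Lflat →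
        ∃ col₀ : Chroma, HasUnitContent (chromaticL col₀ Lsharp Lflat)) :
    ∀ (W : WeierstrassCurve ℚ) [W.IsElliptic] [W.IsGloballyMinimal] (p : ℕ) [Fact p.Prime],
      ClassX8 W p → ¬ Surj W p → W.analyticRank = 0 →
      (∃ q : ℚ, shaAn W = (q : ℂ) ∧ padicValRat p q ≤ 0) →
      ∀ col : Chroma, SprungSharpFlatMainConjecture W p col ∧ SprungSharpFlatLowerDivisibility W p col := by
  intro W _ _ p _ hX hns h0 hsha col
  have hMC :=
    X8.sprungSharpFlatMainConjecture_of_oneColourRider_of_shaAn_le_of_not_surj_of_analyticRank_eq_zero W p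
      h22 hCK h714 h716 h59 h3 hGZK hmod hX hns h0 (hrider W p hX hns h0) hsha col
  exact ⟨hMC, sprungSharpFlatLowerDivisibility_of_mainConjecture hMC⟩

end ClassForms

end Summit.BirchSwinnertonDyer.BirchSwinnertonDyer.Theorems.PrintX8SmallImageRiderBothColours

end
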